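import Summits.Ventures.PercRepro.C041PendantSeeds

/-!
# ROW C-041 — THE PENDANT-GENERATED CLASS 𝒵₁ ⊆ 𝒵 AS ONE INDUCTIVE PREDICATE, AND ITS THEOREM (p6, gen 29;
C-041.md §20 (b)(3))

`IsZ Z k` — the anchored zones generated from the seeds — the zone of a rooted marked tree at its root (`tree`),
any zone whose marks all sit at one vertex (`oneVertex`) — by PENDANT ATTACHMENT at any vertex of any unmarked
multigraph (`pendant`) and by zone isomorphism (`iso`).  THE THEOREM: every member satisfies the invariant (P)
(`IsZ.K4_counts`, by induction — the seeds of `C041PendantSeeds` and `K4_pendant` / `ZoneIso.K4_iff`), hence the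
one-anchor CONJECTURE (ZONE CS) (`IsZ.zoneCSConj`) and the ZONE O-CUBE (`IsZ.zoneOCubeConj`), for EVERY choice of
the finiteness instances (they are subsingletons).  This is the sub-class 𝒵₁ of mine-3's class 𝒵 («every block of
the block–cut tree rooted at the anchor has at most one exit towards the marks») generated WITHOUT the other
operation of §20 (b)(3), the gluing of two MARKED members at the anchor: that product step needs the six-vector
(cone) form — the invariant (P) of the 4-vector alone does not see the split of the invalid states it multiplies —
and is not included here.
-/

namespace PercRepro

namespace ZoneZ

open ZoneData TreeClosure Pendant Finset

/-- **THE PENDANT-GENERATED CLASS 𝒵₁ ⊆ 𝒵** (C-041.md §20 (b)(3)): anchored zones generated from tree zones and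
one-marked-vertex zones by pendant attachment at vertices of unmarked multigraphs and by zone isomorphism (the
gluing of two marked members at the anchor is NOT among the generators). -/
inductive IsZ : {V E T₁ T₂ : Type} → ZoneData V E T₁ T₂ → V → Prop
  /-- the zone of a rooted marked tree, anchored at its root -/
  | tree (t : TZ) : IsZ t.toZone t.root
  /-- a zone whose marks all sit at one vertex, anchored anywhere -/
  | oneVertex {V E T₁ T₂ : Type} (Z : ZoneData V E T₁ T₂) (k v : V) (h1 : ∀ i, Z.at₁ i = v)
      (h2 : ∀ j, Z.at₂ j = v) : IsZ Z k
  /-- a member hung at any vertex of any unmarked multigraph, anchored at any vertex of the latter -/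
  | pendant {V₁ E₁ U₁ U₂ V₂ E₂ T₁ T₂ : Type} (Z₁ : ZoneData V₁ E₁ U₁ U₂) (u a : V₁) (Z₂ : ZoneData V₂ E₂ T₁ T₂)
      (a₂ : V₂) : IsZ Z₂ a₂ → IsZ (Pendant.pendant Z₁ u Z₂ a₂) (Sum.inl a)
  /-- an isomorphic copy of a member -/
  | iso {V E T₁ T₂ V' E' T₁' T₂' : Type} {Z : ZoneData V E T₁ T₂} {Z' : ZoneData V' E' T₁' T₂'} (k : V)
      (φ : ZoneIso Z Z') : IsZ Z k → IsZ Z' (φ.v k)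

/-- **THE INVARIANT (P) ON THE CLASS 𝒵₁**, for every choice of the finiteness instances. -/
theorem IsZ.K4_counts {V E T₁ T₂ : Type} {Z : ZoneData V E T₁ T₂} {k : V} (h : IsZ Z k) :
    ∀ (iE : Fintype E) (dE : DecidableEq E) (i₁ : Fintype T₁) (d₁ : DecidableEq T₁) (i₂ : Fintype T₂)
      (d₂ : DecidableEq T₂),
      K4 (#(@Fset V E T₁ T₂ Z k iE dE i₁ d₁ i₂ d₂) : ℝ) (#(@T1set V E T₁ T₂ Z k iE dE i₁ d₁ i₂ d₂))
        (#(@T2set V E T₁ T₂ Z k iE dE i₁ d₁ i₂ d₂)) (#(@Iset V E T₁ T₂ Z k iE dE i₁ d₁ i₂ d₂)) := by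
  induction h with
  | tree t =>
    intro iE dE i₁ d₁ i₂ d₂
    cases Subsingleton.elim iE (TZ.edgeFintype t)
    cases Subsingleton.elim dE (TZ.edgeDecEq t)
    cases Subsingleton.elim i₁ (TZ.m1Fintype t)
    cases Subsingleton.elim d₁ (TZ.m1DecEq t)
    cases Subsingleton.elim i₂ (TZ.m2Fintype t)
    cases Subsingleton.elim d₂ (TZ.m2DecEq t)
    exact t.K4_toZone
  | oneVertex Z k v h1 h2 =>
    intro iE dE i₁ d₁ i₂ d₂
    exact K4_oneVertex Z k v h1 h2
  | @pendant V₁ E₁ U₁ U₂ V₂ E₂ T₁ T₂ Z₁ u a Z₂ a₂ _ ih =>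
    intro iE dE i₁ d₁ i₂ d₂
    haveI : Finite (E₁ ⊕ E₂) := Finite.of_fintype _
    haveI hf₁ : Finite E₁ := Finite.of_injective (Sum.inl : E₁ → E₁ ⊕ E₂) Sum.inl_injective
    haveI hf₂ : Finite E₂ := Finite.of_injective (Sum.inr : E₂ → E₁ ⊕ E₂) Sum.inr_injective
    letI jE₁ : Fintype E₁ := Fintype.ofFinite E₁
    letI jE₂ : Fintype E₂ := Fintype.ofFinite E₂
    letI eE₁ : DecidableEq E₁ := Classical.decEq E₁
    letI eE₂ : DecidableEq E₂ := Classical.decEq E₂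
    cases Subsingleton.elim iE (@instFintypeSum E₁ E₂ jE₁ jE₂)
    cases Subsingleton.elim dE (@instDecidableEqSum E₁ E₂ eE₁ eE₂)
    exact K4_pendant Z₁ u Z₂ a₂ a (ih jE₂ eE₂ i₁ d₁ i₂ d₂)
  | @iso V E T₁ T₂ V' E' T₁' T₂' Z Z' k φ _ ih =>
    intro iE dE i₁ d₁ i₂ d₂
    haveI : Finite E' := Finite.of_fintype _
    haveI : Finite T₁' := Finite.of_fintype _
    haveI : Finite T₂' := Finite.of_fintype _
    haveI hfE : Finite E := Finite.of_injective φ.e φ.e.injective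
    haveI hf₁ : Finite T₁ := Finite.of_injective φ.t₁ φ.t₁.injective
    haveI hf₂ : Finite T₂ := Finite.of_injective φ.t₂ φ.t₂.injective
    letI jE : Fintype E := Fintype.ofFinite E
    letI j₁ : Fintype T₁ := Fintype.ofFinite T₁
    letI j₂ : Fintype T₂ := Fintype.ofFinite T₂
    letI eE : DecidableEq E := Classical.decEq E
    letI e₁ : DecidableEq T₁ := Classical.decEq T₁
    letI e₂ : DecidableEq T₂ := Classical.decEq T₂
    exact (ZoneIso.K4_iff Z k φ).2 (ih jE eE j₁ e₁ j₂ e₂)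

/-- **THE ONE-ANCHOR (CS) ON THE CLASS 𝒵₁.** -/
theorem IsZ.zoneCSConj {V E T₁ T₂ : Type} {Z : ZoneData V E T₁ T₂} {k : V} (h : IsZ Z k) [Fintype E]
    [DecidableEq E] [Fintype T₁] [DecidableEq T₁] [Fintype T₂] [DecidableEq T₂] :
    Z.ZoneCSConj {k} (∅ : Set V) := by
  have hK := h.K4_counts ‹_› ‹_› ‹_› ‹_› ‹_› ‹_›
  rw [zoneCSConj_single_iff]
  have hle : #(Z.Iset k) ≤ #(Z.Fset k) := by exact_mod_cast hK.k_le_g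
  have h2 : (((#(Z.Fset k) - #(Z.Iset k) : ℕ) : ℝ)) ^ 2 ≤ ((#(Z.T1set k) * #(Z.T2set k) : ℕ) : ℝ) := by
    rw [Nat.cast_sub hle]
    push_cast
    exact hK.cs
  exact_mod_cast h2

/-- **THE ZONE O-CUBE ON THE CLASS 𝒵₁** — mine-3's CONJECTURE (ZONE O-CUBE) is a theorem on every zone of the
class: trees, one-marked-vertex zones, and everything obtained from them by hanging at vertices of unmarked
multigraphs, up to isomorphism. -/
theorem IsZ.zoneOCubeConj {V E T₁ T₂ : Type} {Z : ZoneData V E T₁ T₂} {k : V} (h : IsZ Z k) [Fintype E]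
    [DecidableEq E] [Fintype T₁] [DecidableEq T₁] [Fintype T₂] [DecidableEq T₂] :
    Z.ZoneOCubeConj {k} (∅ : Set V) :=
  zoneOCubeConj_of_zoneCS Z {k} ∅ h.zoneCSConj

end ZoneZ

end PercRepro
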